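import Summits.QuantumAdvantage.QuantumAdvantage.Theses.LinnikCubicClassGroups

/-!
# Crux `LinnikCubicClassGroups.PureCubicClassGroupFBQP` (stmt-QuantumAdvantage-11544) — stub `stub_subgroupOrder`, helper: the relation lattice

Helper for the post-processing step of the hardest stub `stub_subgroupOrder` (line
`arakelov-giant-step-cycle`, S5): the quantum core outputs the INDEX `[ℤ^T : Λ]` of the relation lattice
`Λ = {v ∈ ℤ^T | ∏ cᵢ^{vᵢ} = 1}` of the classes `c₁, …, c_T` of the given degree-one primes (Howell/Smith
engine on the recovered dual lattice), while the stub's relation asks for the ORDER of the subgroup of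
`Cl(𝓞 K)` they generate. This file records, def-free and for any commutative group, that the two numbers
agree: the exponent map `v ↦ ∏ cᵢ^{vᵢ}` exists as a homomorphism `ℤ^T → G`, its kernel is the relation
lattice, its image is the subgroup generated by the `cᵢ`, and the index of the kernel is the order of the
image. [folklore; Hallgren 2005 §4, Cohen GTM 138 §5.5 (relation lattice)]
-/

namespace Summit.QuantumAdvantage.QuantumAdvantage.Theorems.LinnikCubicClassGroups

open scoped BigOperators

/-- **The exponent homomorphism of a finite family.** For `c : Fin T → G` in a commutative group there is a
group homomorphism `φ : ℤ^T → G` (written multiplicatively on `Multiplicative (Fin T → ℤ)`) with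
`φ v = ∏ᵢ cᵢ ^ vᵢ`. [folklore] -/
theorem exists_zpowProd_hom {G : Type*} [CommGroup G] {T : ℕ} (c : Fin T → G) :
    ∃ φ : Multiplicative (Fin T → ℤ) →* G, ∀ v : Fin T → ℤ, φ (Multiplicative.ofAdd v) = ∏ i, c i ^ v i := by
  refine ⟨{ toFun := fun v => ∏ i, c i ^ (Multiplicative.toAdd v) i, map_one' := by simp,
            map_mul' := fun v w => ?_ }, fun v => by simp⟩
  simp only [toAdd_mul, Pi.add_apply, zpow_add, Finset.prod_mul_distrib]

/-- **The image of the exponent homomorphism is the generated subgroup**: `φ(ℤ^T) = ⟨c₁, …, c_T⟩`.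
[folklore] -/
theorem range_zpowProd_hom_eq_closure {G : Type*} [CommGroup G] {T : ℕ} (c : Fin T → G)
    (φ : Multiplicative (Fin T → ℤ) →* G) (hφ : ∀ v : Fin T → ℤ, φ (Multiplicative.ofAdd v) = ∏ i, c i ^ v i) :
    φ.range = Subgroup.closure (Set.range c) := by
  ext x
  rw [MonoidHom.mem_range, Subgroup.mem_closure_range_iff_of_fintype]
  constructor
  · rintro ⟨v, rfl⟩
    exact ⟨Multiplicative.toAdd v, by rw [← hφ]; rfl⟩
  · rintro ⟨a, rfl⟩
    exact ⟨Multiplicative.ofAdd a, hφ a⟩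

/-- **The kernel of the exponent homomorphism is the relation lattice**: `v ∈ ker φ ↔ ∏ᵢ cᵢ^{vᵢ} = 1`.
[folklore] -/
theorem mem_ker_zpowProd_hom_iff {G : Type*} [CommGroup G] {T : ℕ} (c : Fin T → G)
    (φ : Multiplicative (Fin T → ℤ) →* G) (hφ : ∀ v : Fin T → ℤ, φ (Multiplicative.ofAdd v) = ∏ i, c i ^ v i)
    (v : Fin T → ℤ) : Multiplicative.ofAdd v ∈ φ.ker ↔ ∏ i, c i ^ v i = 1 := by
  rw [MonoidHom.mem_ker, hφ]

/-- **Relation-lattice index = order of the generated subgroup.** For the exponent homomorphism `φ` of a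
family `c : Fin T → G` in a commutative group, `[ℤ^T : ker φ] = |⟨c₁, …, c_T⟩|` (as natural numbers, with
Mathlib's conventions `index = 0` / `Nat.card = 0` in the infinite case). This is the identity behind the
output step of `stub_subgroupOrder`: the algorithm computes the index of the relation lattice, the relation
asks for `Nat.card (Subgroup.closure …)`. [cite: Hallgren2005, §4] -/
theorem index_ker_zpowProd_hom_eq_card_closure {G : Type*} [CommGroup G] {T : ℕ} (c : Fin T → G)
    (φ : Multiplicative (Fin T → ℤ) →* G) (hφ : ∀ v : Fin T → ℤ, φ (Multiplicative.ofAdd v) = ∏ i, c i ^ v i) :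
    φ.ker.index = Nat.card (Subgroup.closure (Set.range c)) := by
  rw [Subgroup.index_ker, range_zpowProd_hom_eq_closure c φ hφ]

/-- **Corollary (the form used with a finite generating SET).** If `S ⊆ G` is the range of the family `c`,
then the order of `Subgroup.closure S` is the index of the relation lattice of `c`; in particular it divides
`Nat.card G`. [folklore] -/
theorem card_closure_eq_index_of_range_eq {G : Type*} [CommGroup G] {T : ℕ} (c : Fin T → G) {S : Set G}
    (hS : Set.range c = S) (φ : Multiplicative (Fin T → ℤ) →* G)
    (hφ : ∀ v : Fin T → ℤ, φ (Multiplicative.ofAdd v) = ∏ i, c i ^ v i) :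
    Nat.card (Subgroup.closure S) = φ.ker.index ∧ Nat.card (Subgroup.closure S) ∣ Nat.card G := by
  subst hS
  exact ⟨(index_ker_zpowProd_hom_eq_card_closure c φ hφ).symm, Subgroup.card_subgroup_dvd_card _⟩

/-- **S5c `stub_relationLatticeIndex`** (registered stub of the skeleton `Lines/arakelov-giant-step-cycle.lean` of crux
stmt-QuantumAdvantage-11544): the exponent homomorphism of a finite family in a commutative group exists and the index
of its kernel (the relation lattice) is the order of the generated subgroup. [folklore; Hallgren 2005 §4] -/
theorem stub_relationLatticeIndex : ∀ (G : Type) [CommGroup G] (T : ℕ) (c : Fin T → G),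
      ∃ φ : Multiplicative (Fin T → ℤ) →* G, (∀ v : Fin T → ℤ, φ (Multiplicative.ofAdd v) = ∏ i, c i ^ v i) ∧
        φ.ker.index = Nat.card (Subgroup.closure (Set.range c)) := by
  intro G _ T c
  obtain ⟨φ, hφ⟩ := exists_zpowProd_hom c
  exact ⟨φ, hφ, index_ker_zpowProd_hom_eq_card_closure c φ hφ⟩

end Summit.QuantumAdvantage.QuantumAdvantage.Theorems.LinnikCubicClassGroups
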